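import Literature.Geometry.GeometricMeasureTheory.ClosureCarrier
import Literature.Geometry.GeometricMeasureTheory.RectifiableUpperDensity
import Literature.Geometry.GeometricMeasureTheory.BlowUpSlicesRectifiable
import Literature.Geometry.GeometricMeasureTheory.BlowUpIntegralDensity
import Literature.Geometry.GeometricMeasureTheory.ApproxTangentSubmanifold
import Mathlib.Analysis.Calculus.TangentCone.Seq
import HarnessLib

/-!
# Weak limits of rectifiable cycles are rectifiable (White's closure theorem, cycle case)

Support file for the proof of the named fact
`Literature.Geometry.GeometricMeasureTheory.Federer1969_compactness_integralCurrents` along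
B. White's structure-theorem-free proof of the closure theorem [White1989]: **if rectifiable
`(k+1)`-cycles `Tᵢ` of bounded mass supported in a fixed compact set converge weakly to `T`, then
`T` is rectifiable** — given the induction hypothesis (dimension `k`) consumed by the slicing step
`LimitSlicesRectifiable`.

"Run 2" of the blow-up analysis. By `ClosureCarrier`, `‖T‖` is carried by a Borel countably
`(k+1)`-rectifiable set `M₁` of finite `𝓗^{k+1}`-measure, so `T = σ ∧ ξ` with
`σ = 𝓗^{k+1} ⌞ M`, `M ⊆ M₁` Borel, `ξ ∈ L¹(σ)` (polar decomposition and Radon–Nikodym). For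
`σ`-a.e. `a` the hypotheses of the blow-up analysis hold (`ae_blowUp_hypotheses`: the upper density
bound `Θ^{*(k+1)}(σ, ·) ≤ 1` now comes from the area formula on rectifiable pieces,
`RectifiableUpperDensity`, and orthogonal projections do not increase `𝓗^{k+1}`), so the blow-ups
of `σ` at `a` converge vaguely to `𝓗^{k+1} ⌞ W_a` with `W_a` a `(k+1)`-plane and
`ξ(a) = c_a e⃗_a` simple (`BlowUpTangentPlane`); the slices of the cone limit are rectifiable
(`BlowUpSlicesRectifiable`), hence `c_a ∈ ℤ` (`BlowUpIntegralDensity`); and the cone property of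
`σ` at `a` forces `Tan^{k+1}(σ, a) = W_a`. This is exactly the data of a rectifiable current
`[M, c, e⃗] = σ ∧ ξ = T`.

* `posTangentConeAt_subset_of_norm_le`, `upperDensity_restrict_compl_cone_eq_zero`,
  `approxTangentCone_subset_of_coneDensity` — the cone property pins down the approximate tangent
  cone;
* `exists_orthonormal_frame`, `projection_le_restrict`, `exists_growth_setIntegral` — bookkeeping;
* **`Current.isRectifiable_of_cycle_of_slices`** — White's reduction in its own right: a
  `(k+1)`-CYCLE of finite mass and compact support whose sphere slices `∂(T ⌞ 𝐁(x,r))` are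
  rectifiable for every centre and almost every radius is rectifiable (given the induction
  hypothesis in dimension `k`, which enters through the slices of the cone limits);
* **`Current.isRectifiable_of_tendsto_cycles`** — the theorem (the weak limit is such a cycle by
  `LimitSlicesRectifiable`).

## References

* B. White, *A new proof of the compactness theorem for integral currents*, Comment. Math. Helv.
  64 (1989) 207–220, Step 5 and the conclusion of the proof [White1989].
* L. Bandara, *The closure theorem for integral currents without the structure theorem*,
  B.Sc. thesis, ANU 2006, proof of Thm. 4.2.1, pp. 39–45 (held copy
  `lit paper:galaxy-pdf-8023002039701172160`) [Bandara2006].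
* H. Federer, *Geometric Measure Theory*, Springer 1969, 3.2.16, 4.1.28 [Federer1969].
-/

noncomputable section

open scoped ENNReal NNReal Topology
open MeasureTheory TopologicalSpace Set Filter Metric Function

namespace Literature.Geometry.GeometricMeasureTheory

-- Nested operator-norm instances on (duals of) `E [⋀^Fin m]→L[ℝ] ℝ`, as in `Currents.lean`.
set_option maxSynthPendingDepth 3

variable {V : Type*} [NormedAddCommGroup V] [InnerProductSpace ℝ V] [FiniteDimensional ℝ V]
  [MeasurableSpace V] [BorelSpace V] {k : ℕ}

/-! ### The cone property determines the approximate tangent cone -/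

section TangentCone

omit [FiniteDimensional ℝ V] [MeasurableSpace V] [BorelSpace V] in
/-- Tangent vectors of the closed cone `{x : ‖P(x − a)‖ ≤ t‖x − a‖}` at its vertex satisfy
`‖P v‖ ≤ t‖v‖`. [cite: Federer1969, 3.1.21] -/
theorem posTangentConeAt_subset_of_norm_le (P : V →L[ℝ] V) (a : V) (t : ℝ) :
    posTangentConeAt {x : V | ‖P (x - a)‖ ≤ t * ‖x - a‖} a ⊆ {v : V | ‖P v‖ ≤ t * ‖v‖} := by
  intro v hv
  obtain ⟨c, d, -, hds, hcd⟩ := mem_tangentConeAt_iff_exists_seq.1 hv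
  have h1 : Tendsto (fun n => ‖P (c n • d n)‖) atTop (𝓝 ‖P v‖) :=
    ((P.continuous.tendsto v).comp hcd).norm
  have h2 : Tendsto (fun n => t * ‖c n • d n‖) atTop (𝓝 (t * ‖v‖)) :=
    hcd.norm.const_mul t
  refine le_of_tendsto_of_tendsto h1 h2 (hds.mono fun n hn => ?_)
  rw [mem_setOf_eq, add_sub_cancel_left] at hn
  show ‖P (c n • d n)‖ ≤ t * ‖c n • d n‖
  rw [NNReal.smul_def, map_smul, norm_smul, norm_smul, Real.norm_of_nonneg (c n).coe_nonneg,
    mul_left_comm]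
  exact mul_le_mul_of_nonneg_left hn (c n).coe_nonneg

/-- **The cone property kills the density off a cone**: if
`r^{-(k+1)} μ{‖x − a‖ ≤ r, t‖x − a‖ ≤ ‖P_{W^⊥}(x − a)‖} → 0`, then
`Θ^{*(k+1)}(μ ⌞ Sᶜ, a) = 0` for the closed cone `S = {‖P_{W^⊥}(x − a)‖ ≤ t‖x − a‖}`.
[cite: Federer1969, 3.2.16; White1989, p. 217] -/
theorem upperDensity_restrict_compl_cone_eq_zero (μ : Measure V) (a : V) (W : Submodule ℝ V)
    {t : ℝ}
    (hcone : Tendsto (fun r : ℝ => ENNReal.ofReal ((r⁻¹) ^ (k + 1)) *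
      μ {x : V | ‖x - a‖ ≤ r ∧ t * ‖x - a‖ ≤ ‖Wᗮ.starProjection (x - a)‖}) (𝓝[>] 0) (𝓝 0)) :
    upperDensity (k + 1) (μ.restrict {x : V | ‖Wᗮ.starProjection (x - a)‖ ≤ t * ‖x - a‖}ᶜ) a
      = 0 := by
  set α : ℝ≥0∞ := unitBallVolume (k + 1) with hα
  have hα0 : α ≠ 0 := unitBallVolume_ne_zero _
  have hαT : α ≠ ⊤ := unitBallVolume_ne_top _
  set E : ℝ → Set V := fun r =>
    {x : V | ‖x - a‖ ≤ r ∧ t * ‖x - a‖ ≤ ‖Wᗮ.starProjection (x - a)‖} with hE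
  -- the comparison function `g(r) = r^{-(k+1)} μ(E_r) α⁻¹ → 0`
  have hg : Tendsto (fun r : ℝ => ENNReal.ofReal ((r⁻¹) ^ (k + 1)) * μ (E r) * α⁻¹)
      (𝓝[>] 0) (𝓝 0) := by
    have h := ENNReal.Tendsto.mul_const hcone (Or.inr (ENNReal.inv_ne_top.2 hα0))
    rwa [zero_mul] at h
  unfold upperDensity
  refine le_antisymm ?_ bot_le
  rw [← hg.limsup_eq]
  refine limsup_le_limsup (f := 𝓝[>] (0 : ℝ)) ?_
  filter_upwards [self_mem_nhdsWithin] with r hr0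
  rw [mem_Ioi] at hr0
  have hrk : (0 : ℝ) < r ^ (k + 1) := by positivity
  have hsub : closedBall a r ∩ {x : V | ‖Wᗮ.starProjection (x - a)‖ ≤ t * ‖x - a‖}ᶜ ⊆ E r := by
    rintro x ⟨hxb, hxc⟩
    rw [mem_compl_iff, mem_setOf_eq, not_le] at hxc
    exact ⟨by rwa [mem_closedBall, dist_eq_norm] at hxb, hxc.le⟩
  rw [Measure.restrict_apply measurableSet_closedBall]
  calc μ (closedBall a r ∩ {x : V | ‖Wᗮ.starProjection (x - a)‖ ≤ t * ‖x - a‖}ᶜ) /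
        (α * ENNReal.ofReal (r ^ (k + 1)))
      ≤ μ (E r) / (α * ENNReal.ofReal (r ^ (k + 1))) := by gcongr
    _ = ENNReal.ofReal ((r⁻¹) ^ (k + 1)) * μ (E r) * α⁻¹ := by
        rw [div_eq_mul_inv, ENNReal.mul_inv (Or.inl hα0) (Or.inl hαT), inv_pow,
          ENNReal.ofReal_inv_of_pos hrk]
        ring

/-- **The cone property pins down the approximate tangent cone**: if for every `t > 0`
`r^{-(k+1)} μ{‖x − a‖ ≤ r, t‖x − a‖ ≤ ‖P_{W^⊥}(x − a)‖} → 0` as `r → 0⁺`, then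
`Tan^{k+1}(μ, a) ⊆ W`. [cite: Federer1969, 3.2.16; White1989, p. 217] -/
theorem approxTangentCone_subset_of_coneDensity (μ : Measure V) (a : V) (W : Submodule ℝ V)
    (hcone : ∀ t : ℝ, 0 < t → Tendsto (fun r : ℝ => ENNReal.ofReal ((r⁻¹) ^ (k + 1)) *
      μ {x : V | ‖x - a‖ ≤ r ∧ t * ‖x - a‖ ≤ ‖Wᗮ.starProjection (x - a)‖}) (𝓝[>] 0) (𝓝 0)) :
    approxTangentCone (k + 1) μ a ⊆ (W : Set V) := by
  intro v hv
  -- `‖P_{W^⊥} v‖ ≤ t‖v‖` for every `t > 0`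
  have hle : ∀ t : ℝ, 0 < t → ‖Wᗮ.starProjection v‖ ≤ t * ‖v‖ := by
    intro t ht
    have hmem : v ∈ posTangentConeAt {x : V | ‖Wᗮ.starProjection (x - a)‖ ≤ t * ‖x - a‖} a :=
      (mem_iInter₂.1 hv) _ (upperDensity_restrict_compl_cone_eq_zero μ a W (hcone t ht))
    exact posTangentConeAt_subset_of_norm_le _ a t hmem
  have h0 : ‖Wᗮ.starProjection v‖ = 0 := by
    refine le_antisymm (le_of_forall_pos_le_add fun ε hε => ?_) (norm_nonneg _)
    rw [zero_add]
    by_cases hv0 : ‖v‖ = 0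
    · calc ‖Wᗮ.starProjection v‖ ≤ 1 * ‖v‖ := hle 1 one_pos
        _ ≤ ε := by rw [hv0, mul_zero]; exact hε.le
    · have hvpos : 0 < ‖v‖ := (norm_nonneg v).lt_of_ne (Ne.symm hv0)
      calc ‖Wᗮ.starProjection v‖ ≤ ε / ‖v‖ * ‖v‖ := hle _ (div_pos hε hvpos)
        _ = ε := div_mul_cancel₀ ε hv0
  rw [norm_eq_zero, Submodule.starProjection_orthogonal_val, sub_eq_zero] at h0
  rw [SetLike.mem_coe, h0]
  exact Submodule.starProjection_apply_mem W v

end TangentCone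

/-! ### Bookkeeping -/

section Bookkeeping

omit [MeasurableSpace V] [BorelSpace V] in
/-- An orthonormal frame `e : Fin (k+1) → V` of a `(k+1)`-dimensional subspace. [folklore] -/
private theorem exists_orthonormal_frame (W : Submodule ℝ V) (hdim : Module.finrank ℝ W = k + 1) :
    ∃ e : Fin (k + 1) → V, Orthonormal ℝ e ∧ (∀ i, e i ∈ W) ∧
      Submodule.span ℝ (Set.range e) = W := by
  set b : OrthonormalBasis (Fin (k + 1)) ℝ W := (stdOrthonormalBasis ℝ W).reindex (finCongr hdim)
    with hb
  refine ⟨fun i => (b i : V), W.subtypeₗᵢ.orthonormal_comp_iff.2 b.orthonormal, fun i => (b i).2, ?_⟩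
  have h1 : (Set.range fun i => (b i : V)) = W.subtype '' Set.range ⇑b := by
    rw [← Set.range_comp]; rfl
  rw [h1, Submodule.span_image, ← OrthonormalBasis.coe_toBasis, b.toBasis.span_eq,
    Submodule.map_subtype_top]

/-- Orthogonal projections onto `(k+1)`-planes do not increase `𝓗^{k+1} ⌞ M` on subsets of `M`.
[cite: Federer1969, 2.10.11] -/
theorem projection_le_restrict (M : Set V) (hM : MeasurableSet M) :
    ∀ W : Submodule ℝ V, Module.finrank ℝ W = k + 1 →
      ∀ A ⊆ M, (μHE[k + 1] : Measure V) (W.starProjection '' A) ≤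
        ((μHE[k + 1] : Measure V).restrict M) A := by
  intro W _ A hA
  have h := W.lipschitzWith_starProjection.hausdorffMeasure_image_le
    (by positivity : (0 : ℝ) ≤ ((k + 1 : ℕ) : ℝ)) A
  rw [ENNReal.coe_one, ENNReal.one_rpow, one_mul] at h
  rw [Measure.restrict_apply' hM, inter_eq_self_of_subset_left hA,
    Measure.euclideanHausdorffMeasure_def, Measure.smul_apply, Measure.smul_apply, ENNReal.smul_def,
    ENNReal.smul_def, smul_eq_mul, smul_eq_mul]
  gcongr

variable {σ : Measure V} {ξ : V → Multivector V (k + 1)}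

omit [FiniteDimensional ℝ V] in
/-- **Growth of `∫_{𝐁(a,s)} ‖ξ‖ dσ`** at a Lebesgue point with `σ(𝐁(a,s)) ≤ K s^{k+1}`:
`∫_{𝐁(a,s)} ‖ξ‖ dσ ≤ K' s^{k+1}` for all `s > 0`. [cite: White1989, p. 217] -/
theorem exists_growth_setIntegral [IsFiniteMeasure σ] (hξ : Integrable ξ σ) {a : V} {Kσ : ℝ≥0∞}
    (hKσ : Kσ ≠ ⊤)
    (hgrowth : ∀ s : ℝ, 0 < s → σ (closedBall a s) ≤ Kσ * ENNReal.ofReal (s ^ (k + 1)))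
    (hLeb : Tendsto (fun r => (r⁻¹) ^ (k + 1) * ∫ x in closedBall a r, ‖ξ x - ξ a‖ ∂σ)
      (𝓝[>] 0) (𝓝 0)) :
    ∃ K : ℝ, ∀ s : ℝ, 0 < s → ∫ x in closedBall a s, ‖ξ x‖ ∂σ ≤ K * s ^ (k + 1) := by
  -- a radius below which `∫_𝐁 ‖ξ − ξ(a)‖ ≤ s^{k+1}`
  have hev := hLeb.eventually (gt_mem_nhds one_pos)
  rw [eventually_nhdsWithin_iff, Metric.eventually_nhds_iff] at hev
  obtain ⟨δ, hδ, hδ'⟩ := hev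
  set I : ℝ := ∫ x, ‖ξ x‖ ∂σ with hI
  have hI0 : 0 ≤ I := integral_nonneg fun _ => norm_nonneg _
  have hδk : (0 : ℝ) < δ ^ (k + 1) := by positivity
  set K : ℝ := ‖ξ a‖ * Kσ.toReal + 1 + I / δ ^ (k + 1) with hK
  have hK1 : 0 ≤ ‖ξ a‖ * Kσ.toReal := by positivity
  have hK3 : 0 ≤ I / δ ^ (k + 1) := by positivity
  refine ⟨K, fun s hs => ?_⟩
  have hsk : (0 : ℝ) < s ^ (k + 1) := by positivity
  have hsub : Integrable (fun x => ‖ξ x - ξ a‖) σ := (hξ.sub' (integrable_const _)).norm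
  by_cases hsδ : s < δ
  · -- small radii
    have hL : (s⁻¹) ^ (k + 1) * ∫ x in closedBall a s, ‖ξ x - ξ a‖ ∂σ < 1 :=
      hδ' (by rwa [Real.dist_eq, sub_zero, abs_of_pos hs]) hs
    rw [inv_pow, inv_mul_lt_iff₀ hsk, mul_one] at hL
    have hσs : (σ (closedBall a s)).toReal ≤ Kσ.toReal * s ^ (k + 1) := by
      have h := ENNReal.toReal_mono (ENNReal.mul_ne_top hKσ ENNReal.ofReal_ne_top) (hgrowth s hs)
      rwa [ENNReal.toReal_mul, ENNReal.toReal_ofReal hsk.le] at h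
    have h1 : ∫ x in closedBall a s, ‖ξ x‖ ∂σ ≤
        ‖ξ a‖ * (σ (closedBall a s)).toReal + ∫ x in closedBall a s, ‖ξ x - ξ a‖ ∂σ := by
      calc ∫ x in closedBall a s, ‖ξ x‖ ∂σ
          ≤ ∫ x in closedBall a s, (‖ξ a‖ + ‖ξ x - ξ a‖) ∂σ :=
            setIntegral_mono_on hξ.norm.integrableOn
              ((integrable_const (‖ξ a‖)).add hsub).integrableOn measurableSet_closedBall
              fun x _ => norm_le_insert' _ _
        _ = ‖ξ a‖ * (σ (closedBall a s)).toReal + ∫ x in closedBall a s, ‖ξ x - ξ a‖ ∂σ := by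
            rw [integral_add (integrable_const _).integrableOn hsub.integrableOn, setIntegral_const,
              smul_eq_mul, mul_comm, Measure.real]
    calc ∫ x in closedBall a s, ‖ξ x‖ ∂σ
        ≤ ‖ξ a‖ * (Kσ.toReal * s ^ (k + 1)) + s ^ (k + 1) := by
          refine h1.trans (add_le_add (mul_le_mul_of_nonneg_left hσs (norm_nonneg _)) hL.le)
      _ = (‖ξ a‖ * Kσ.toReal + 1) * s ^ (k + 1) := by ring
      _ ≤ K * s ^ (k + 1) := by
          refine mul_le_mul_of_nonneg_right ?_ hsk.le
          rw [hK]; linarith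
  · -- large radii
    rw [not_lt] at hsδ
    have hpow : δ ^ (k + 1) ≤ s ^ (k + 1) := pow_le_pow_left₀ hδ.le hsδ _
    calc ∫ x in closedBall a s, ‖ξ x‖ ∂σ ≤ I :=
          setIntegral_le_integral hξ.norm (Eventually.of_forall fun _ => norm_nonneg _)
      _ ≤ I / δ ^ (k + 1) * s ^ (k + 1) := by
          rw [div_mul_eq_mul_div, le_div_iff₀ hδk]
          exact mul_le_mul_of_nonneg_left hpow hI0
      _ ≤ K * s ^ (k + 1) := by
          refine mul_le_mul_of_nonneg_right ?_ hsk.le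
          rw [hK]; linarith

end Bookkeeping

/-! ### The theorem -/

section Main

/-- **A cycle with rectifiable sphere slices is rectifiable** (White: "the proof of the closure
theorem will be reduced to showing that a boundaryless current with rectifiable slices must be
rectifiable", p. 210): if `T` is a `(k+1)`-cycle of finite mass and compact support such that for
every centre `x` and almost every radius `r > 0` the slice `∂(T ⌞ 𝐁(x,r))` is a rectifiable
`k`-current, and weak limits of rectifiable `k`-dimensional boundaries of bounded mass and support
are rectifiable (the induction hypothesis, used on the slices of the cone limits), then `T` is a
rectifiable current. [cite: White1989, p. 210, Theorem p. 211 and Step 5; Bandara2006, Thm. 4.2.1] -/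
theorem Current.isRectifiable_of_cycle_of_slices (hkn : k + 1 ≤ Module.finrank ℝ V)
    (IH : ∀ (K' : Set V), IsCompact K' → ∀ (c' : ℝ≥0∞), c' ≠ ⊤ →
      ∀ (Q : ℕ → Current (⊤ : Opens V) (k + 1)) (Z' : Current (⊤ : Opens V) k),
        (∀ i, (Q i).boundary.IsRectifiable ∧ (Q i).boundary.support ⊆ K' ∧
          (Q i).boundary.mass ≤ c') →
        (∀ φ, Tendsto (fun i => (Q i).boundary φ) atTop (𝓝 (Z' φ))) → Z'.IsRectifiable)
    {T' : Current (⊤ : Opens V) (k + 1)} (hT'm : T'.mass ≠ ⊤) (hT'0 : T'.boundary = 0)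
    (hT'c : IsCompact T'.support)
    (hslices : ∀ x, ∀ᵐ r : ℝ, 0 < r →
      ((T'.isRepresentable_of_mass_ne_top hT'm).restrictSet (closedBall x r)
        measurableSet_closedBall).boundary.IsRectifiable) :
    T'.IsRectifiable := by
  classical
  -- Step 0: `T'` is a normal cycle of finite mass with compact support
  have hdT' : T'.boundary.mass ≠ ⊤ := by rw [hT'0, Current.mass_zero]; exact ENNReal.zero_ne_top
  haveI : IsFiniteMeasure T'.variation := T'.isFiniteMeasure_variation hT'm
  -- Step 1: the lower density bound from the rectifiable sphere slices
  obtain ⟨β, hβ, hlow⟩ : ∃ β : ℝ, 0 < β ∧ ∀ᵐ x ∂T'.variation, ∀ᶠ r in 𝓝[>] (0 : ℝ),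
      ENNReal.ofReal ((β * r) ^ (k + 1)) ≤ T'.variation (closedBall x r) := by
    cases k with
    | zero =>
      obtain ⟨β, hβ, h⟩ := Current.lowerDensityBound_one (V := V)
      refine ⟨β, hβ, ?_⟩
      have h' := h T' hT'm hT'0 (ae_of_all _ hslices)
      simpa only [zero_add, pow_one] using h'
    | succ k' =>
      obtain ⟨β, hβ, h⟩ := Current.lowerDensityBound (V := V) k' (by omega)
      exact ⟨β, hβ, h T' hT'm hT'0 (ae_of_all _ hslices)⟩
  -- Step 2: the rectifiable carrier and `T' = σ ∧ ξ`, `σ = 𝓗^{k+1} ⌞ M`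
  obtain ⟨M₁, hM₁m, hM₁r, hM₁fin, hM₁null⟩ :=
    Current.exists_rectifiable_carrier_of_slices hkn hT'm hT'0 hT'c hslices
  set H : Measure V := (μHE[k + 1] : Measure V) with hH
  haveI : IsFiniteMeasure (H.restrict M₁) := isFiniteMeasure_restrict.2 hM₁fin
  have hac₀ : T'.variation ≪ H.restrict M₁ := by
    intro A hA
    rw [Measure.restrict_apply' hM₁m] at hA
    have h1 : T'.variation (A ∩ M₁) = 0 :=
      T'.variation_eq_zero_of_euclideanHausdorffMeasure_eq_zero hT'm hdT' hT'c hA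
    refine nonpos_iff_eq_zero.1 ?_
    calc T'.variation A ≤ T'.variation (A ∩ M₁ ∪ M₁ᶜ) :=
          measure_mono fun x hx => by
            by_cases h : x ∈ M₁
            · exact Or.inl ⟨hx, h⟩
            · exact Or.inr h
      _ ≤ T'.variation (A ∩ M₁) + T'.variation M₁ᶜ := measure_union_le _ _
      _ = 0 := by rw [h1, hM₁null, add_zero]
  obtain ⟨ξ, hξm, hξi₀, hTξ₀, hvar₀⟩ :=
    T'.exists_eq_vectorCurrent_of_absolutelyContinuous hT'm (H.restrict M₁) hac₀
  have hSm : MeasurableSet {x : V | ξ x ≠ 0} :=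
    (hξm.measurableSet_eq_fun stronglyMeasurable_const).compl
  set M : Set V := {x : V | ξ x ≠ 0} ∩ M₁ with hMdef
  have hMm : MeasurableSet M := hSm.inter hM₁m
  have hMr : IsCountablyRectifiable (k + 1) M := hM₁r.mono inter_subset_right
  have hMfin : H M ≠ ⊤ := ne_top_of_le_ne_top hM₁fin (measure_mono inter_subset_right)
  set σ : Measure V := H.restrict M with hσdef
  have hσeq : (H.restrict M₁).restrict {x : V | ξ x ≠ 0} = σ := by
    rw [hσdef, hMdef, Measure.restrict_restrict hSm]
  obtain ⟨hTξ, hvar, hσT⟩ := vectorCurrent_restrict_support_density hξm hTξ₀ hvar₀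
  rw [hσeq] at hTξ hvar hσT
  haveI hσfin : IsFiniteMeasure σ := isFiniteMeasure_restrict.2 hMfin
  have hξi : Integrable ξ σ := by
    rw [← hσeq]; exact hξi₀.restrict
  have hloc : LocallyIntegrableOn ξ ((⊤ : Opens V) : Set V) σ :=
    hξi.locallyIntegrable.locallyIntegrableOn _
  -- Step 3: the hypotheses of the blow-up analysis, `σ`-a.e.
  have hA : ∀ᵐ x ∂σ, ∀ᶠ r in 𝓝[>] (0 : ℝ),
      (β * r) ^ (k + 1) ≤ ∫ x' in closedBall x r, ‖ξ x'‖ ∂σ :=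
    ae_setIntegral_lowerDensity hξi hvar hσT hβ hlow
  have hup : ∀ᵐ x ∂σ, ∀ t : ℝ≥0∞, 1 < t → ∀ᶠ r in 𝓝[>] (0 : ℝ),
      σ (closedBall x r) ≤ t * (unitBallVolume (k + 1) * ENNReal.ofReal (r ^ (k + 1))) :=
    ae_eventually_closedBall_le_of_isCountablyRectifiable hMm hMr hMfin
  have hgood := ae_blowUp_hypotheses hξi hβ hA hup
  have hTcyc : (vectorCurrent σ ξ : Current (⊤ : Opens V) (k + 1)).boundary = 0 := by
    rw [← hTξ]; exact hT'0
  have hMc : σ Mᶜ = 0 := by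
    rw [hσdef, Measure.restrict_apply hMm.compl, compl_inter_self, measure_empty]
  have hproj := projection_le_restrict (k := k) M hMm
  have hTan := ae_exists_subspace_subset_approxTangentCone (m := k + 1) hMm hMr
  -- sphere slices of `σ ∧ ξ` around every point
  have key : ∀ (S : Current (⊤ : Opens V) (k + 1)) (hS : S.mass ≠ ⊤), S = vectorCurrent σ ξ →
      ∀ (x : V) (r : ℝ), (S.isRepresentable_of_mass_ne_top hS).restrictSet (closedBall x r)
        measurableSet_closedBall = vectorCurrent (σ.restrict (closedBall x r)) ξ := by
    rintro S hS rfl x r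
    exact restrictSet_vectorCurrent hloc _
  have hslicesσ : ∀ x, ∀ᵐ r : ℝ, 0 < r →
      (vectorCurrent (σ.restrict (closedBall x r)) ξ :
        Current (⊤ : Opens V) (k + 1)).boundary.IsRectifiable := by
    intro x
    filter_upwards [hslices x] with r hr hr0
    rw [← key T' hT'm hTξ x r]
    exact hr hr0
  -- Step 4: at `σ`-a.e. point: tangent plane, simple unit vector, INTEGER density
  have hstruct : ∀ᵐ a ∂σ, ∃ en : (Fin (k + 1) → V) × ℤ, Orthonormal ℝ en.1 ∧
      ((Submodule.span ℝ (Set.range en.1) : Set V) = approxTangentCone (k + 1) σ a) ∧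
      ξ a = (en.2 : ℝ) • frameVector en.1 := by
    filter_upwards [hgood, hTan] with a ha hTa
    obtain ⟨hLeb, ⟨j, haj, hdens⟩, hξa, ⟨Kg, hKg, hgrowth⟩, hupa⟩ := ha
    have hr₁ : (0 : ℝ) < ((j : ℝ) + 1)⁻¹ := by positivity
    have hM' : ∀ x ∈ lowerDensitySet σ ξ β ((j : ℝ) + 1)⁻¹, ∀ r, 0 < r → r ≤ ((j : ℝ) + 1)⁻¹ →
        (β * r) ^ (k + 1) ≤ ∫ x' in closedBall x r, ‖ξ x'‖ ∂σ := fun x hx => mem_lowerDensitySet.1 hx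
    -- the blow-up sequence `λ_l = 1/(l+1)` and its vague limit `𝓗^{k+1} ⌞ W`
    set lam : ℕ → ℝ := fun l => ((l : ℝ) + 1)⁻¹ with hlam
    have hlampos : ∀ l, 0 < lam l := fun l => by positivity
    have hlam0 : Tendsto lam atTop (𝓝 0) :=
      tendsto_one_div_add_atTop_nhds_zero_nat.congr fun n => one_div _
    set W : Submodule ℝ V := (ξ a).invariantSubspace with hW
    have hv := vagueTendsto_blowUp_of_good hξi hTcyc hMc hproj hLeb hβ hr₁ haj hM' hdens hξa hKg
      hgrowth hupa hlampos hlam0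
    rw [← hW] at hv
    obtain ⟨ι₀, ν₀, hι₀, hν₀, hv₀⟩ := Measure.exists_subseq_vagueTendsto_blowUp σ (m := k + 1) hKg
      hgrowth (r := lam) hlampos
    haveI := hν₀
    have hdim : Module.finrank ℝ W = k + 1 :=
      (blowUpLimit_eq_restrict_invariantSubspace hξi hTcyc hMc hproj (lam := fun l => lam (ι₀ l))
        (fun l => hlampos _) (hlam0.comp hι₀.tendsto_atTop) hv₀ hLeb hβ hr₁ haj hM' hdens hξa
        hupa).1
    haveI hνlf : IsLocallyFiniteMeasure (H.restrict W) :=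
      isLocallyFiniteMeasure_restrict_submodule W hdim
    -- an orthonormal frame of `W` and the coefficient of `ξ(a)`
    obtain ⟨e, he, heW, hspan⟩ := exists_orthonormal_frame W hdim
    set c₀ : ℝ := (ξ a) (frameCovector e) with hc₀
    have hξc : ξ a = c₀ • frameVector e :=
      blowUpLimit_vectorfield_eq_smul_frameVector ξ a hdim he heW
    -- the cone limit `(𝓗 ⌞ W) ∧ c₀ e` is a cycle with rectifiable slices, so `c₀ ∈ ℤ`
    have hC0 : (vectorCurrent (H.restrict W) (fun _ => c₀ • frameVector e) :
        Current (⊤ : Opens V) (k + 1)).boundary = 0 := by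
      have h := boundary_blowUpLimit_eq_zero hξi hTcyc hlampos hlam0 hv hLeb
      rwa [hξc] at h
    obtain ⟨K', hK'⟩ := exists_growth_setIntegral hξi hKg hgrowth hLeb
    have hgrowth' : ∀ s, 0 < s → ((vectorCurrent σ ξ : Current (⊤ : Opens V) (k + 1)).variation
        (closedBall a s)).toReal ≤ K' * s ^ (k + 1) := by
      intro s hs
      rw [← hTξ, variation_toReal_eq_setIntegral hξi hvar measurableSet_closedBall]
      exact hK' s hs
    have hν : ∀ ρ, (H.restrict W) (sphere 0 ρ) = 0 := fun ρ => by
      rw [Measure.restrict_apply isClosed_sphere.measurableSet, inter_comm]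
      exact euclideanHausdorffMeasure_submodule_inter_sphere W hdim ρ
    have hsl := ae_isRectifiable_boundary_blowUpLimit_piece IH hξi hTcyc (hslicesσ a) hgrowth'
      hlampos hlam0 hv hLeb hν
    obtain ⟨ρ, hρsl, hρ⟩ : ∃ ρ : ℝ, (0 < ρ →
        (vectorCurrent ((H.restrict W).restrict (closedBall 0 ρ)) (fun _ => ξ a) :
          Current (⊤ : Opens V) (k + 1)).boundary.IsRectifiable) ∧ 0 < ρ := by
      have h1 : ∀ᵐ ρ ∂(volume.restrict (Ioi (0 : ℝ))), (0 < ρ →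
          (vectorCurrent ((H.restrict W).restrict (closedBall 0 ρ)) (fun _ => ξ a) :
            Current (⊤ : Opens V) (k + 1)).boundary.IsRectifiable) ∧ 0 < ρ :=
        (ae_restrict_of_ae hsl).and ((ae_restrict_mem measurableSet_Ioi).mono fun ρ h => h)
      haveI : (ae (volume.restrict (Ioi (0 : ℝ)))).NeBot := by
        rw [ae_neBot, Ne, Measure.restrict_eq_zero, Real.volume_Ioi]; exact ENNReal.top_ne_zero
      exact h1.exists
    have hZ := hρsl hρ
    rw [hξc] at hZ
    obtain ⟨n, hn⟩ := exists_int_eq_of_isRectifiable_slice W hdim he heW c₀ hρ hC0 hZ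
    -- the tangent plane is `W`
    have hsub : approxTangentCone (k + 1) σ a ⊆ (W : Set V) :=
      approxTangentCone_subset_of_coneDensity σ a W fun t ht =>
        tendsto_blowUp_coneCompl_of_good hξi hTcyc hMc hproj hLeb hβ hr₁ haj hM' hdens hξa hKg
          hgrowth hupa ht
    obtain ⟨L, hL, hLT⟩ := hTa
    have hTanW : approxTangentCone (k + 1) σ a = (W : Set V) :=
      eq_of_subspace_sandwich hLT hsub (by rw [hdim, hL])
    exact ⟨(e, n), he, by rw [hspan, hTanW], by rw [hξc, hn]⟩
  -- Step 5: the data of a rectifiable current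
  set data : V → (Fin (k + 1) → V) × ℤ := fun a =>
    if h : ∃ en : (Fin (k + 1) → V) × ℤ, Orthonormal ℝ en.1 ∧
        ((Submodule.span ℝ (Set.range en.1) : Set V) = approxTangentCone (k + 1) σ a) ∧
        ξ a = (en.2 : ℝ) • frameVector en.1 then h.choose else (fun _ => 0, 0) with hdata
  have hdataP : ∀ᵐ a ∂σ, Orthonormal ℝ (data a).1 ∧
      ((Submodule.span ℝ (Set.range (data a).1) : Set V) = approxTangentCone (k + 1) σ a) ∧
      ξ a = ((data a).2 : ℝ) • frameVector (data a).1 := by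
    filter_upwards [hstruct] with a ha
    have h1 : data a = ha.choose := by
      simp only [hdata]
      rw [dif_pos ha]
    rw [h1]
    exact ha.choose_spec
  have hRD : IsRectifiableData (⊤ : Opens V) (k + 1) M (fun a => (data a).2) (fun a => (data a).1) := by
    refine ⟨hMm, subset_univ _, hMr, ?_, ?_⟩
    · have hae : ξ =ᵐ[σ] fun a => (((data a).2 : ℤ) : ℝ) • frameVector (data a).1 :=
        hdataP.mono fun a ha => ha.2.2
      exact (hξi.congr hae).locallyIntegrable.locallyIntegrableOn _
    · exact hdataP.mono fun a ha => ⟨ha.1, ha.2.1⟩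
  have hTeq : T' = currentOfIntegration M (fun a => (data a).2) (fun a => (data a).1) := by
    rw [hTξ]
    unfold currentOfIntegration
    exact vectorCurrent_congr_ae (hdataP.mono fun a ha => ha.2.2)
  exact ⟨⟨M, _, _, hRD, hTeq⟩, hT'c⟩

/-- **Weak limits of rectifiable cycles are rectifiable** ([White1989]; the cycle case of the
closure theorem [Federer1969, 4.2.16 (2)] without the structure theorem): if rectifiable
`(k+1)`-cycles `Tᵢ` with `spt Tᵢ ⊆ K` compact and `𝐌(Tᵢ) ≤ c` converge weakly to `T`, and weak
limits of rectifiable `k`-dimensional boundaries of bounded mass and support are rectifiable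
(induction hypothesis), then `T` is a rectifiable current: the limit is a normal cycle with
compact support whose sphere slices are rectifiable (`LimitSlicesRectifiable`), so
`Current.isRectifiable_of_cycle_of_slices` applies.
[cite: White1989, Theorem p. 211 and Step 5; Bandara2006, Thm. 4.2.1; Federer1969, 4.2.16] -/
theorem Current.isRectifiable_of_tendsto_cycles (hkn : k + 1 ≤ Module.finrank ℝ V)
    (IH : ∀ (K' : Set V), IsCompact K' → ∀ (c' : ℝ≥0∞), c' ≠ ⊤ →
      ∀ (Q : ℕ → Current (⊤ : Opens V) (k + 1)) (Z' : Current (⊤ : Opens V) k),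
        (∀ i, (Q i).boundary.IsRectifiable ∧ (Q i).boundary.support ⊆ K' ∧
          (Q i).boundary.mass ≤ c') →
        (∀ φ, Tendsto (fun i => (Q i).boundary φ) atTop (𝓝 (Z' φ))) → Z'.IsRectifiable)
    {K : Set V} (hK : IsCompact K) {c : ℝ≥0∞} (hc : c ≠ ⊤)
    {T : ℕ → Current (⊤ : Opens V) (k + 1)} {T' : Current (⊤ : Opens V) (k + 1)}
    (hT : ∀ i, (T i).IsRectifiable ∧ (T i).boundary = 0 ∧ (T i).support ⊆ K ∧ (T i).mass ≤ c)
    (hconv : ∀ φ, Tendsto (fun i => T i φ) atTop (𝓝 (T' φ))) :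
    T'.IsRectifiable := by
  -- `T'` is a normal cycle of finite mass with compact support
  have hT'm : T'.mass ≠ ⊤ :=
    ne_top_of_le_ne_top hc (Current.mass_le_of_tendsto hconv fun i => (hT i).2.2.2)
  have hT'0 : T'.boundary = 0 :=
    Current.boundary_eq_zero_of_tendsto (l := atTop) hconv fun i => (hT i).2.1
  have hT'K : T'.support ⊆ K :=
    Current.support_subset_of_tendsto hconv hK.isClosed fun i => (hT i).2.2.1
  have hT'c : IsCompact T'.support := T'.isCompact_support_of_subset hK (subset_univ _) hT'K
  -- a.e. sphere slice of `T'` is rectifiable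
  have hslices : ∀ x, ∀ᵐ r : ℝ, 0 < r →
      ((T'.isRepresentable_of_mass_ne_top hT'm).restrictSet (closedBall x r)
        measurableSet_closedBall).boundary.IsRectifiable :=
    fun x => Current.ae_isRectifiable_boundary_piece_of_tendsto hkn IH hK hc hT hconv hT'm x
  exact Current.isRectifiable_of_cycle_of_slices hkn IH hT'm hT'0 hT'c hslices

end Main

end Literature.Geometry.GeometricMeasureTheory
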